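import Literature.Analysis.FluidPDE.PassiveVectorTensorGardingDivergence
import Literature.Analysis.FluidPDE.PassiveVectorTensorTransverseCanonical
import HarnessLib

/-!
# p5 g17 certifier — 3-PROBE (d: dischargeability) of p730365 `…VmodLossAdjDuality` / p729091 `…VmodLossDuality`

The (S2-core)/(S2-adj) engines carry the hypothesis

  `hQ : ∀ ξ : Fin 3 → Fin 3 → ℝ, 0 ≤ Σ_{l,i,c,e} 𝔹₀ i c l e * ξ c i * ξ e l`

(pointwise FULL nonnegativity of the quadratic form of `𝔹₀` on ALL `3 × 3` matrices).  The tensor binders of record (K1L_D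
`SlowVectorClauseEulerPieceTK`: `OddSmall S β`, `NearIso S (lo/lam) (hi·lam)`; D1: `NearIso S (10/11) (11/10)`, `OddSectorial S τ`) are
TRANSVERSE conditions.  This file certifies that they do NOT imply `hQ`:

* `Sbad := isoVisc 1 + traceL (−100 • 1)` is transversely equal to `isoVisc 1` (`traceL` is transverse-null, T♮0), hence has the BEST window
  `NearIso Sbad 1 1` (so every window `lo ≤ 1 ≤ hi`, `lam = 1`) and `OddSmall Sbad β` for every `β`;
* yet its quadratic form at `ξ = 1` is `3 − 900 < 0`: `¬ hQ`.

So `hQ` can never be supplied inside the `∀ S` clause; the usable replacement is the INTEGRATED floor on `G`-solenoidal fields — the twisted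
Gårding inequality (E2′, in tree, recorded by name below) after transverse canonicalisation (T♮1) and transverse-class invariance of the
distorted class for holonomic frames (T♮2) — with the dual field `χ` restricted to `G(t₀−σ)`-solenoidal tests.
-/

set_option linter.dupNamespace false

namespace Summit.AnomalousDissipation.AnomalousDissipation.Theorems.SolenoidalFractalHomogenisation.LagrangianStep.P5ProbeLossAdjHQ

open Literature.Analysis Literature.Analysis.FluidPDE

/-- The witness tensor: scalar viscosity `1` plus a large transverse-null `traceL` term. -/
noncomputable def Sbad : Torus.Visc4 (Fin 3) :=
  Torus.isoVisc 1 + Torus.Visc4.traceL ((-100 : ℝ) • (1 : Matrix (Fin 3) (Fin 3) ℝ))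

theorem transverseEq_isoVisc_Sbad : Torus.TransverseEq (Torus.isoVisc 1) Sbad :=
  (Torus.isTransverseNull_traceL _).transverseEq_add

/-- (d₁) the best transverse window. -/
theorem Sbad_nearIso : Torus.NearIso Sbad 1 1 :=
  (transverseEq_isoVisc_Sbad.nearIso_iff 1 1).1 (Torus.nearIso_isoVisc 1)

/-- (d₁′) hence every window of record with `lam = 1`. -/
theorem Sbad_nearIso_window {lo hi : ℝ} (hlo : lo ≤ 1) (hhi : 1 ≤ hi) : Torus.NearIso Sbad lo hi :=
  Sbad_nearIso.mono hlo hhi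

/-- (d₂) every odd-part bound. -/
theorem Sbad_oddSmall (β : ℝ) : Torus.OddSmall Sbad β :=
  (transverseEq_isoVisc_Sbad.oddSmall_iff β).1 (Torus.oddSmall_isoVisc 1 β)

/-- (d₃) the K1L_D-shaped binder pair `OddSmall S β ∧ ∃ lam ∈ [1,Λ], NearIso S (lo/lam) (hi·lam)` holds for `Sbad`. -/
theorem Sbad_binders {lo hi Λ β : ℝ} (hlo : lo ≤ 1) (hhi : 1 ≤ hi) (hΛ : 1 ≤ Λ) :
    Torus.OddSmall Sbad β ∧ ∃ lam ∈ Set.Icc (1:ℝ) Λ, Torus.NearIso Sbad (lo / lam) (hi * lam) :=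
  ⟨Sbad_oddSmall β, 1, ⟨le_rfl, hΛ⟩, by simpa using Sbad_nearIso_window hlo hhi⟩

/-- (d₄) **`hQ` FAILS for `Sbad`**: the full quadratic form is negative at `ξ = 1`. -/
theorem Sbad_quadForm_one :
    ∑ l, ∑ i, ∑ c, ∑ e, Sbad i c l e * (1 : Matrix (Fin 3) (Fin 3) ℝ) c i * (1 : Matrix (Fin 3) (Fin 3) ℝ) e l = -897 := by
  simp only [Fin.sum_univ_three, Sbad, Pi.add_apply, Torus.isoVisc, Torus.Visc4.traceL, Matrix.smul_apply, Matrix.one_apply,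
    smul_eq_mul, Fin.isValue]
  norm_num [Fin.ext_iff]

theorem not_hQ_Sbad : ¬ ∀ ξ : Fin 3 → Fin 3 → ℝ, 0 ≤ ∑ l, ∑ i, ∑ c, ∑ e, Sbad i c l e * ξ c i * ξ e l := by
  intro h
  have h1 := h (1 : Matrix (Fin 3) (Fin 3) ℝ)
  rw [Sbad_quadForm_one] at h1
  norm_num at h1

/-- (d₅) the same for every positive multiple `κ • Sbad` (the clause's tensors are `(1/n²) • S`, `k̄ • S`) and for the major transpose
(the adjoint member's tensor). -/
theorem not_hQ_smul_Sbad {κ : ℝ} (hκ : 0 < κ) :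
    ¬ ∀ ξ : Fin 3 → Fin 3 → ℝ, 0 ≤ ∑ l, ∑ i, ∑ c, ∑ e, (κ • Sbad) i c l e * ξ c i * ξ e l := by
  intro h
  have h1 := h (1 : Matrix (Fin 3) (Fin 3) ℝ)
  have e : ∑ l, ∑ i, ∑ c, ∑ e, (κ • Sbad) i c l e * (1 : Matrix (Fin 3) (Fin 3) ℝ) c i * (1 : Matrix (Fin 3) (Fin 3) ℝ) e l
      = κ * ∑ l, ∑ i, ∑ c, ∑ e, Sbad i c l e * (1 : Matrix (Fin 3) (Fin 3) ℝ) c i * (1 : Matrix (Fin 3) (Fin 3) ℝ) e l := by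
    simp only [Pi.smul_apply, smul_eq_mul, Finset.mul_sum]
    exact Finset.sum_congr rfl fun _ _ => Finset.sum_congr rfl fun _ _ => Finset.sum_congr rfl fun _ _ =>
      Finset.sum_congr rfl fun _ _ => by ring
  rw [e, Sbad_quadForm_one] at h1
  nlinarith

theorem majorTranspose_Sbad_quadForm_one :
    ∑ l, ∑ i, ∑ c, ∑ e, Torus.majorTranspose Sbad i c l e * (1 : Matrix (Fin 3) (Fin 3) ℝ) c i * (1 : Matrix (Fin 3) (Fin 3) ℝ) e l
      = -897 := by
  simp only [Fin.sum_univ_three, Torus.majorTranspose_apply, Sbad, Pi.add_apply, Torus.isoVisc, Torus.Visc4.traceL, Matrix.smul_apply,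
    Matrix.one_apply, smul_eq_mul, Fin.isValue]
  norm_num [Fin.ext_iff]

theorem not_hQ_majorTranspose_Sbad :
    ¬ ∀ ξ : Fin 3 → Fin 3 → ℝ, 0 ≤ ∑ l, ∑ i, ∑ c, ∑ e, Torus.majorTranspose Sbad i c l e * ξ c i * ξ e l := by
  intro h
  have h1 := h (1 : Matrix (Fin 3) (Fin 3) ℝ)
  rw [majorTranspose_Sbad_quadForm_one] at h1
  norm_num at h1

/-! ## The in-tree remedy, BY NAME (E2′ twisted Gårding; T♮1 canonicalisation; T♮2 transverse-class invariance, holonomic frames) -/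

example := @Literature.Analysis.FluidPDE.Torus.integral_inner_viscAdjVar_conj_self_le_of_isDivFree_distort
example := @Literature.Analysis.FluidPDE.Torus.transverseCanonical
example := @Literature.Analysis.FluidPDE.Torus.IsWeakTensorPassiveVectorDistortedOn.of_transverseEq

end Summit.AnomalousDissipation.AnomalousDissipation.Theorems.SolenoidalFractalHomogenisation.LagrangianStep.P5ProbeLossAdjHQ
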